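import Literature.AnabelianGeometry.EtaleTheta.Discharge.Sec5OfConnectedTemperoid
import Literature.AnabelianGeometry.EtaleTheta.BiKummerRootComposition

/-!
# [EtTh] Prop. 5.2 (i), FIRST alternative, for the §5 data over `B^temp(Π^tp_X)⁰` — modulo the Rmk. 4.3.2 closure inputs (C1)/(C2) only (p.324 / PDF p.98)

Mochizuki, *The étale theta function …*, Publ. RIMS **45** (2009), Prop. 5.2 (i) p.324 (PDF p.98): "The pair of morphisms of `C`
determined by `s_{l·N}`, `τ_{l·N}` constitutes an `l·N`-th root of a right fraction-pair of … `Θ̈` …, or, alternatively, an `N`-th root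
of a right fraction-pair of … an `l`-th root of … `Θ̈` [cf. Remark 4.3.2]" [cite: MochizukiEtTh2009, Prop 5.2 (i) p.324 (PDF p.98)].
Seat abc-iut-L2-t4 (§5 owner), ROW W3-L2-01 «§5 GENUINE DATA»; PROOF-ONLY.  Additive.

The SECOND alternative holds for the assembled §5 data by construction (`pairIsNthRoot_ofBiKummerData`); the FIRST — the tree's
`FrobenioidThetaBiKummer.ThetaPairIsRoot` — was left modulo the composite-root binder `hcomp` (GAP G-L2t4-1;
`thetaPairIsRoot_ofModelData`).  abc-iut-w5-d234's `BiKummerSetting.NthRoot.hcomp_of` (`BiKummerRootComposition.lean`, p424490)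
derives `hcomp` from the Rmk. 4.3.2 closure inputs (C1) a base-Frobenius datum `Dc` of the composite `α ≫ α_l` with (C1′) its
pull-back compatibility `hD`, (C2) the `(l·N, H_⊙)`-saturation `hsat`, (C3) multiplicativity of the pull-back `hpow`.  Here, for the
§5 data `ThetaFrobenioid.ofConnectedTemperoidData` over the genuine connected base:
* `thetaPairIsRoot_ofConnectedTemperoidData` — Prop. 5.2 (i), first alternative, modulo (C1)(C1′)(C2)(C3) + `pullFrac (𝟙 _) = id`;
* `thetaPairIsRoot_ofConnectedTemperoidData_of_pullFracModel` — for any rendering `pullFrac` agreeing with abc-iut-L2-t9's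
  `pullFracModel` (the model's `((α')^birat)^*`), (C3) and the identity law are THEOREMS (`map_pow`, `pullFracModel_id`; cf.
  abc-iut-L2-t5's `Sec4PullFracModelPow.lean`), so the first alternative holds modulo (C1)(C1′)(C2) = GAP rows G-L2t4-1a, G-L2t4-1b alone.
HONEST FRAMING: kernel-checked implications; `Dc`, `hD`, `hsat` are the named residual inputs (the paper CHOOSES compatible roots,
Rmk. 4.3.2); no side taken downstream.
-/

noncomputable section

namespace Literature.AnabelianGeometry.EtaleTheta

open CategoryTheory Opposite Literature.AlgebraicGeometry.Frobenioids Literature.AnabelianGeometry.SemiGraphs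
  Literature.AnabelianGeometry.SemiGraphs.GaloisObjects

universe u₀ v₀ w

namespace ThetaFrobenioid

variable {K : Type u₀} [Field K] {X : SemiGraphs.TemperedArithmeticGroup.{u₀} K} {D₀ : Type u₀} [Category.{v₀} D₀]
  {V : FrdIMonoidStub.{w}} {T₀ : RealifiedDivisorMonoids (D₀ := D₀) V}
  {VD : FrdICatStub.{u₀ + 1, u₀, w} (ConnectedPart (BTemp X.Pi))}
  {tf : TemperedFrobenioid T₀ (ConnectedPart (BTemp X.Pi)) VD} {hZ : tf.monoidType = MonoidType.Z}
  {hP : ∀ A : (ConnectedPart (BTemp X.Pi))ᵒᵖ, IsPerfect (tf.Φ.carrier A)}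
  {NH : Subgroup (Field.absoluteGaloisGroup K) → tf.category → ℕ+ → Prop} {A₀ : tf.category}
  {hA₀ : PreFrobenioid.IsFrobeniusTrivial tf.toElem A₀} {hA₀' : SemiGraphs.IsGaloisObj A₀.base.obj}
  {pullFrac : ∀ {A A' : (BiKummerSetting.mkOfConnectedTemperoid X tf hZ hP NH A₀ hA₀ hA₀').C} (_ : A' ⟶ A),
    (BiKummerSetting.mkOfConnectedTemperoid X tf hZ hP NH A₀ hA₀ hA₀').biratUnits A →
      (BiKummerSetting.mkOfConnectedTemperoid X tf hZ hP NH A₀ hA₀ hA₀').biratUnits A'}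
  {lv N : ℕ+} {T : ThetaEnvData.{max u₀ w} N}
  {θ : (BiKummerSetting.mkOfConnectedTemperoid X tf hZ hP NH A₀ hA₀ hA₀').biratUnits
    (BiKummerSetting.mkOfConnectedTemperoid X tf hZ hP NH A₀ hA₀ hA₀').Aodot}
  {Bl : (BiKummerSetting.mkOfConnectedTemperoid X tf hZ hP NH A₀ hA₀ hA₀').C}
  {Pl : (BiKummerSetting.mkOfConnectedTemperoid X tf hZ hP NH A₀ hA₀ hA₀').FractionPair θ Bl}
  {Rl : (BiKummerSetting.mkOfConnectedTemperoid X tf hZ hP NH A₀ hA₀ hA₀').NthRoot θ Pl lv pullFrac}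
  (h : ModelFrobenioid.Hypotheses tf.divisorMonoid tf.ratFnFunctor)
  (Q : FrobenioidTheta.ThetaSubquotientStub.{w} (ConnectedPart (BTemp X.Pi))) (odd_l : Odd (lv : ℕ))
  (R : (BiKummerSetting.mkOfConnectedTemperoid X tf hZ hP NH A₀ hA₀ hA₀').NthRoot Rl.root Rl.pair N pullFrac)
  (ιX : T.PiX ≃ₜ* X.Pi) (K' : Type w) [Field K'] (constEmb : K'ˣ →* tf.biratUnitsModel R.BN)
  (constEmb_injective : Function.Injective constEmb)
  (hinvc : ∀ g : Aut R.AN.base,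
    pull tf.divisorMonoid g.hom (ModelFrobenioid.div R.pair.num) = ModelFrobenioid.div R.pair.num)
  (hinvp : ∀ y : T.PiX, y ∈ T.PiYdd →
    pull tf.divisorMonoid ((BiKummerSetting.mkOfConnectedTemperoid X tf hZ hP NH A₀ hA₀ hA₀').galoisSurj R.AN.base
      R.αData.isGalois (ιX y)).hom (ModelFrobenioid.div R.pair.den) = ModelFrobenioid.div R.pair.den)
  (Dc : (BiKummerSetting.mkOfConnectedTemperoid X tf hZ hP NH A₀ hA₀ hA₀').BaseFrobeniusTypeData (R.α ≫ Rl.α))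
  (hD : pullFrac Dc.α₁ θ = pullFrac R.αData.α₁ (pullFrac Rl.αData.α₁ θ))
  (hsat : (BiKummerSetting.mkOfConnectedTemperoid X tf hZ hP NH A₀ hA₀ hA₀').IsSaturated R.AN (lv * N) (pullFrac Dc.α₁ θ))

include Dc hD hsat in
/-- **[EtTh] Prop. 5.2 (i), FIRST alternative, for the §5 data over `B^temp(Π^tp_X)⁰`** — `(s^⊓_N, s^⊔_N)` is an `l·N`-th root of a
right fraction-pair of `Θ̈` — modulo the Rmk. 4.3.2 closure inputs (C1) `Dc`, (C1′) `hD`, (C2) `hsat`, (C3) `hpow` and the identity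
law of the pull-back (abc-iut-w5-d234's `NthRoot.hcomp_of` + `thetaPairIsRoot_ofModelData`).
[cite: MochizukiEtTh2009, Prop 5.2 (i) p.324 (PDF p.98); Rmk 4.3.2 p.318 (PDF p.92)] -/
theorem thetaPairIsRoot_ofConnectedTemperoidData
    (hpull_id : ∀ (A : (BiKummerSetting.mkOfConnectedTemperoid X tf hZ hP NH A₀ hA₀ hA₀').C)
      (x : (BiKummerSetting.mkOfConnectedTemperoid X tf hZ hP NH A₀ hA₀ hA₀').biratUnits A), pullFrac (𝟙 A) x = x)
    (hpow : ∀ (x : (BiKummerSetting.mkOfConnectedTemperoid X tf hZ hP NH A₀ hA₀ hA₀').biratUnits Rl.AN) (n : ℕ),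
      pullFrac R.αData.α₁ (x ^ n) = pullFrac R.αData.α₁ x ^ n) :
    FrobenioidThetaBiKummer.ThetaPairIsRoot
      (ofConnectedTemperoidData h Q odd_l R ιX K' constEmb constEmb_injective hinvc hinvp)
      (FrobenioidThetaBiKummer.BiKummerVocabStub.ofBiKummerSetting
        (BiKummerSetting.mkOfConnectedTemperoid X tf hZ hP NH A₀ hA₀ hA₀') pullFrac _
        fun _ => (MulEquiv.ofBijective (MonoidHom.id _) Function.bijective_id).symm) :=
  thetaPairIsRoot_ofModelData h Q odd_l R ιX _ _ K' constEmb constEmb_injective _ _ hpull_id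
    (BiKummerSetting.NthRoot.hcomp_of Rl R Dc hD hsat hpow)

include Dc hD hsat in
/-- **Prop. 5.2 (i), first alternative, over `B^temp(Π^tp_X)⁰` with the MODEL pull-back** (`pullFrac` agreeing with abc-iut-L2-t9's
`pullFracModel = ((α')^birat)^*`): (C3) and the identity law are theorems (`map_pow`, `pullFracModel_id`), so the statement holds
modulo (C1) `Dc`, (C1′) `hD`, (C2) `hsat` alone (GAP rows G-L2t4-1a, G-L2t4-1b).  [cite: MochizukiEtTh2009, Prop 5.2 (i) p.324 (PDF p.98); Rmk 4.3.2 p.318 (PDF p.92)] -/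
theorem thetaPairIsRoot_ofConnectedTemperoidData_of_pullFracModel
    (hF : ∀ {B B' : (BiKummerSetting.mkOfConnectedTemperoid X tf hZ hP NH A₀ hA₀ hA₀').C} (ψ : B' ⟶ B)
      (y : (BiKummerSetting.mkOfConnectedTemperoid X tf hZ hP NH A₀ hA₀ hA₀').biratUnits B), pullFrac ψ y = tf.pullFracModel ψ y) :
    FrobenioidThetaBiKummer.ThetaPairIsRoot
      (ofConnectedTemperoidData h Q odd_l R ιX K' constEmb constEmb_injective hinvc hinvp)
      (FrobenioidThetaBiKummer.BiKummerVocabStub.ofBiKummerSetting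
        (BiKummerSetting.mkOfConnectedTemperoid X tf hZ hP NH A₀ hA₀ hA₀') pullFrac _
        fun _ => (MulEquiv.ofBijective (MonoidHom.id _) Function.bijective_id).symm) :=
  thetaPairIsRoot_ofConnectedTemperoidData h Q odd_l R ιX K' constEmb constEmb_injective hinvc hinvp Dc hD hsat
    (fun A x => by rw [hF]; exact tf.pullFracModel_id A x)
    (fun x n => by rw [hF, hF]; exact map_pow (tf.pullFracModel R.αData.α₁) x n)

end ThetaFrobenioid

end Literature.AnabelianGeometry.EtaleTheta

end
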